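import Summits.BirchSwinnertonDyer.BirchSwinnertonDyer.Theorems.GoldfeldAllTwistsTwoConverseTwinHeegnerHalvesParityCellAll
import Summits.BirchSwinnertonDyer.BirchSwinnertonDyer.Theorems.PrintCf2SplitBadTwoTorsionSevenDvd
import Literature.NumberTheory.EllipticCurves.MazurTorsionOrderValuationProofs
import Literature.NumberTheory.DiophantineGeometry.AbcWave0GranvilleStarkTheorem2Proofs
import HarnessLib

set_option linter.dupNamespace false -- `…BirchSwinnertonDyer.BirchSwinnertonDyer…` is the cell's namespace (D-0017)
set_option autoImplicit false

/-!
# Twin″ (item 19140) — line «heegner-halves» v2: **THE EXACT VALUE OF `ord₂ 𝔮` ON THE `j = −3375` CELL** — the two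
# half-stubs unwound to explicit inequalities on the `2`-divisibility index of the Heegner point

Leafhand `leafhand-bsd-goldfeldalltwistst-3-g1` (prover, explicit unit, 2026-08-31; director-bsd (719)(3), sub-target «P1 on
the cell»: this is the UNREDUCED form of the P1 computation — the same assembly with equalities instead of parities),
`--supports stmt-BirchSwinnertonDyer-19140` (crux twin″ `BSDTwoCMSevenAdditiveRankOne`, registered skeleton `5ff791a1e67d6e63`
= line «heegner-halves» v2). Theses-free; theorems only; no `sorry`, no definition, no new named fact, no instance, no
notation. HONEST FRAMING: bookkeeping GRANTED the halves' five published binders (Gross–Zagier, Kolyvagin, GZK, modularity,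
Burungale–Flach); it closes NO stub of the line (the two `2`-adic halves stay research-open); item 19140 is NOT closed; BSD
is proved for no curve.

WHAT (`padicValRat_cmHeegnerIndexQuotient_cell_eq`). On the `j = −3375` cell in twist currency (`C • W = X₀(49)^{(d)}`, `d`
squarefree `≢ 1 (mod 4)`, any behaviour at `7`) and for every admissible Heegner datum `(N, K, Dt, H, ι, P, Wd, Cd, k)` as in
the half-stubs (Heegner hypothesis at `N` and at the bad primes `2, 7, ℓ ∣ d`):
**`ord₂ 𝔮 = 2·(ord₂ I + 1 − ord₂ k − ord₂ t_K − ord₂ c) + 3 − ord₂ #Ш(Wd) − (3 + ι(d·D) + 2σ′(d·D)) − (3 + ι(d) + 2σ′(d))`**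
(`I = [W(K) : ℤP]`, `t_K = #W(K)_tors`, `c` the Manin constant of `Dt`, `D = d_K`; `ι`, `σ′` the inert / split-prime-to-`14`
counts). Folded in: `t_W = 2` and `#Wd(ℚ) = #Wd(ℚ)_tors = 2` (cell bsd-print-cf2's
`torsionOrder_eq_two_of_smul_eq_cm7_quadraticTwist'`, the twin being `49a1^{(d·D)}` of rank `0`; `natCard_point_eq_torsionOrder`),
`w_K = 2` (`d_K ≡ 1 (mod 8)` negative, so `< −4`; `torsionOrder_eq_two_of_discr_lt`), `n = 1`, `|u| = 1`
(`abs_u_eq_one_of_twin_minimal`), the uniform Tamagawa law for `W` and `Wd` (`…ParityCellAll` §1), every factor non-zero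
(`heegnerDatum_nondegenerate_of_facts`). CONSEQUENCE for the line: modulo the print stub, the two registered half-stubs are,
on this cell, the explicit inequalities `ord₂ #Ш(W) ≤ / ≥ 2·ord₂ I − 2·ord₂ k − 2·ord₂ t_K − 2·ord₂ c − 1 − ord₂ #Ш(Wd)
− (ι(d) + ι(d·D)) − 2(σ′(d) + σ′(d·D))` — statements about the `2`-divisibility of the Heegner point against `#Ш(W)[2^∞]`,
`#Ш(W^{(D)})[2^∞]`, the halvability value, `#W(K)_tors` and the Manin constant, with no period, `L`-value or Tamagawa
number left. (P1 = the right-hand side is even, `…ParityCellAll`.)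

References: [GrossZagier1986] I.6.3, V.§2; [BurungaleFlach2024] Thm. 1.1, Cor. 2; [Olson1974] Thm. 1; [Silverman1994] IV.9
Table 4.1; [Cox2013] §7.A; [Miller2011LMS] §1.
-/

noncomputable section

open scoped Classical

open WeierstrassCurve NumberField Literature.NumberTheory.EllipticCurves Literature.NumberTheory.QuadraticFields
  Literature.NumberTheory.EllipticCurves.ModularForms Literature.NumberTheory.EllipticCurves.Rank1Residual
  Literature.NumberTheory.EllipticCurves.Rank1Residual.Typed

namespace Summit.BirchSwinnertonDyer.BirchSwinnertonDyer.Theorems.GoldfeldGoodTwists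

open Summit.BirchSwinnertonDyer.Rank1Residual Summit.BirchSwinnertonDyer.Rank1Residual.P2

section ExactOrder

variable {d : ℤ}

/-- For a FINITE Mordell–Weil group, `#W(ℚ) = #W(ℚ)_tors` (`torsionOrder`). [cite: SilvermanAEC2009, VIII.7] -/
theorem natCard_point_eq_torsionOrder (W : WeierstrassCurve ℚ) [W.IsElliptic] [Finite W.toAffine.Point] :
    Nat.card W.toAffine.Point = W.torsionOrder := by
  rw [torsionOrder_eq_natCard_torsion]
  have htop : AddCommGroup.torsion W.toAffine.Point = ⊤ :=
    AddCommGroup.torsion_eq_top_iff.mpr is_add_torsion_of_finite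
  rw [htop, AddSubgroup.card_top]

/-- **THE EXACT VALUE OF `ord₂ 𝔮` ON THE `j = −3375` CELL.** In the data of
`even_padicValRat_cmHeegnerIndexQuotient_of_cellTwist'` (`C • W = X₀(49)^{(d)}`, `d` squarefree `≢ 1 (mod 4)`, `W`, `Wd`
globally minimal, an admissible Heegner datum with the Heegner hypothesis at `N` and at `2, 7, ℓ ∣ d`; GRANTED Gross–Zagier,
Kolyvagin, GZK, modularity, Burungale–Flach — no Cassels–Tate needed here):
`ord₂ 𝔮 = 2·(ord₂ I + 1 − ord₂ k − ord₂ t_K − ord₂ c) + 3 − ord₂ #Ш(Wd) − (3 + ι(d·D) + 2σ′(d·D)) − (3 + ι(d) + 2σ′(d))`,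
where `I = [W(K) : ℤP]`, `t_K = #W(K)_tors`, `c` = the Manin constant of the datum, `D = d_K`, `ι` / `σ′` as in `ParityCore` /
`…ParityCellAll`. The units folded in: `t_W = #W(ℚ)_tors = 2` and `#Wd(ℚ) = #Wd(ℚ)_tors = 2` (Olson; `Wd ≅ 49a1^{(d·D)}` of rank `0`),
`w_K = 2` (`d_K < −4`), `n = 1`, `|u| = 1`, and the uniform Tamagawa law for `W` and `Wd`. So the two half-stubs of the line
read, on this cell: `ord₂ #Ш(W) ≤ / ≥ 2·ord₂ I − 2·ord₂ k − 2·ord₂ t_K − 2·ord₂ c − 1 − ord₂ #Ш(Wd) − (ι(d) + ι(d·D)) − 2(σ′(d) + σ′(d·D))`.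
[cite: GrossZagier1986, Thm. I.6.3 and V.§2] [cite: BurungaleFlach2024, Thm. 1.1 and Cor. 2] [cite: Olson1974, Thm. 1]
[cite: Silverman1994, IV.9 Table 4.1] [cite: Cox2013, §7.A] -/
theorem padicValRat_cmHeegnerIndexQuotient_cell_eq
    (hsq : Squarefree d) (hd4 : d % 4 ≠ 1)
    (W : WeierstrassCurve ℚ) [W.IsElliptic] [W.IsGloballyMinimal] (C : VariableChange ℚ)
    (hC : C • W = cm7.quadraticTwist (d : ℚ))
    (N : ℕ) [NeZero N] (K : Type) [Field K] [NumberField K]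
    (Dt : ModularParametrizationData W N) (H : HeegnerDatum N (NumberField.discr K)) (ι : K →+* ℂ)
    (P : (W.baseChange K).toAffine.Point)
    (hGZ : gross_zagier N W K) (hKo : kolyvagin N W K)
    (hGZK : rank_eq_analyticRank_of_analyticRank_le_one) (hmod : hasEntireLFunction_rat)
    (hBF : bsdTriple_of_hasCM_of_L_one_ne_zero)
    (hK : IsImaginaryQuadratic K) (hHN : SatisfiesHeegnerHypothesis N K)
    (hHd : SatisfiesHeegnerHypothesis (14 * d.natAbs) K)
    (hP : WeierstrassCurve.Affine.Point.map ι.toRatAlgHom P = heegnerPointComplex Dt H)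
    (hr : W.analyticRank = 1)
    (hLt : (W.quadraticTwist (NumberField.discr K : ℚ)).entireLFunction 1 ≠ 0)
    (Wd : WeierstrassCurve ℚ) [Wd.IsElliptic] [Wd.IsGloballyMinimal] (Cd : VariableChange ℚ)
    (hWd : Cd • W.quadraticTwist (NumberField.discr K : ℚ) = Wd) (k : ℕ) (hk12 : k = 1 ∨ k = 2) :
    padicValRat 2 (cmHeegnerIndexQuotient W K P Dt.c k Wd Cd.u) =
      2 * ((padicValNat 2 (AddSubgroup.zmultiples P).index : ℤ) + 1 - (padicValNat 2 k : ℤ)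
            - (padicValNat 2 (W.baseChange K).torsionOrder : ℤ) - padicValRat 2 (Dt.c : ℚ))
        + 3 - (padicValNat 2 Wd.shaOrder : ℤ)
        - ((3 + (((d * NumberField.discr K).natAbs.primeFactors.erase 2).filter
              (fun l : ℕ => jacobiSym l 7 = -1)).card +
            2 * ((((d * NumberField.discr K).natAbs.primeFactors.erase 2).erase 7).filter
              (fun l : ℕ => ¬ jacobiSym l 7 = -1)).card : ℕ) : ℤ)
        - ((3 + ((d.natAbs.primeFactors.erase 2).filter (fun l : ℕ => jacobiSym l 7 = -1)).card +
            2 * (((d.natAbs.primeFactors.erase 2).erase 7).filter (fun l : ℕ => ¬ jacobiSym l 7 = -1)).card : ℕ) : ℤ) := by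
  haveI : Fact (Nat.Prime 2) := ⟨Nat.prime_two⟩
  have hd0 : d ≠ 0 := hsq.ne_zero
  obtain ⟨hj, hcm, -⟩ := minimalModel_quadraticTwist_cm7 hd0 W C hC
  obtain ⟨hDneg, hDsq, hD7, hcop, hsqD, hdD4⟩ := heegnerDiscr_arith_of_split' hK hsq hd4 hHd
  obtain ⟨-, -, -, -, hfinpt, hfind, hI0, -, -⟩ := heegnerDatum_nondegenerate_of_facts W N K Dt H ι P hGZ hKo
    hGZK hmod hBF hcm hK hHN hP hr hLt Wd Cd hWd
  haveI := hfinpt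
  haveI := hfind
  ---------------------------------------------------------------- the folded units
  have hn : (W.baseChange ℝ).numRealComponents = 1 := numRealComponents_eq_one_of_j_eq_neg3375 W hj
  have hu : |(Cd.u : ℚ)| = 1 := abs_u_eq_one_of_twin_minimal hsq hd4 hsqD hdD4 W C hC Wd Cd hWd
  have htW2 : W.torsionOrder = 2 := PrintCf2.TamagawaPlaces.torsionOrder_eq_two_of_smul_eq_cm7_quadraticTwist' hsq hd4 W C hC
  obtain ⟨C', hC', -⟩ := exists_smul_eq_cm7_quadraticTwist_mul W C hC Wd Cd hWd
  have hptsW : Nat.card Wd.toAffine.Point = 2 := by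
    rw [natCard_point_eq_torsionOrder]
    exact PrintCf2.TamagawaPlaces.torsionOrder_eq_two_of_smul_eq_cm7_quadraticTwist' hsqD hdD4 Wd C'
      (by rw [hC', Int.cast_mul])
  have hD8 : NumberField.discr K % 8 = 1 := by
    refine (Quadratic.ncard_primesOver_two_eq_two_iff hK.1).mp ?_
    simpa using hHd 2 Nat.prime_two (dvd_mul_of_dvd_left (by norm_num) _)
  have hw2 : Units.torsionOrder K = 2 :=
    Literature.NumberTheory.DiophantineGeometry.torsionOrder_eq_two_of_discr_lt hK.1 (by omega)
  have hcW := padicValNat_two_tamagawaProduct_of_smul_eq_cm7_quadraticTwist' hsq hd4 W C hC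
  have hcWd := padicValNat_two_tamagawaProduct_twin' hsqD hdD4 W C hC Wd Cd hWd
  ---------------------------------------------------------------- non-vanishing
  have hsha0 : Wd.shaOrder ≠ 0 := (Nat.card_pos (α := Wd.sha)).ne'
  have htK : 0 < (W.baseChange K).torsionOrder := by
    haveI := KrizLi2019.isElliptic_baseChange' W K; exact (W.baseChange K).torsionOrder_pos_holds
  have hcWpos : 0 < W.tamagawaProduct := W.tamagawaProduct_pos_holds
  have hcWdpos : 0 < Wd.tamagawaProduct := Wd.tamagawaProduct_pos_holds
  have hk0 : k ≠ 0 := by rcases hk12 with rfl | rfl <;> norm_num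
  have hcM : (Dt.c : ℚ) ≠ 0 := Int.cast_ne_zero.mpr Dt.maninConstant_ne_zero_holds
  ---------------------------------------------------------------- `𝔮 = s² · t`
  rw [cmHeegnerIndexQuotient_eq_sq_mul W K P Dt.c k Wd Cd.u (by exact_mod_cast hk0) (by exact_mod_cast htK.ne') hcM
    (by rw [hw2]; norm_num) (by rw [hptsW]; norm_num), hn, hu, htW2, hptsW, hw2]
  push_cast
  have hs : ((AddSubgroup.zmultiples P).index : ℚ) * 2 * 2 /
      ((k : ℚ) * ((W.baseChange K).torsionOrder : ℚ) * (Dt.c : ℚ) * 2) ≠ 0 :=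
    div_ne_zero (mul_ne_zero (mul_ne_zero (by exact_mod_cast hI0) two_ne_zero) two_ne_zero)
      (mul_ne_zero (mul_ne_zero (mul_ne_zero (by exact_mod_cast hk0) (by exact_mod_cast htK.ne')) hcM) two_ne_zero)
  have ht : (8 : ℚ) / (1 * (Wd.shaOrder : ℚ) * (Wd.tamagawaProduct : ℚ) * 1 * (W.tamagawaProduct : ℚ)) ≠ 0 :=
    div_ne_zero (by norm_num) (by simp only [one_mul, mul_one]; exact mul_ne_zero (mul_ne_zero
      (by exact_mod_cast hsha0) (by exact_mod_cast hcWdpos.ne')) (by exact_mod_cast hcWpos.ne'))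
  rw [padicValRat.mul (pow_ne_zero _ hs) ht, padicValRat.pow,
    padicValRat.div (mul_ne_zero (mul_ne_zero (by exact_mod_cast hI0) two_ne_zero) two_ne_zero)
      (mul_ne_zero (mul_ne_zero (mul_ne_zero (by exact_mod_cast hk0) (by exact_mod_cast htK.ne')) hcM) two_ne_zero),
    padicValRat.mul (mul_ne_zero (by exact_mod_cast hI0) two_ne_zero) two_ne_zero,
    padicValRat.mul (by exact_mod_cast hI0) two_ne_zero,
    padicValRat.mul (mul_ne_zero (mul_ne_zero (by exact_mod_cast hk0) (by exact_mod_cast htK.ne')) hcM) two_ne_zero,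
    padicValRat.mul (mul_ne_zero (by exact_mod_cast hk0) (by exact_mod_cast htK.ne')) hcM,
    padicValRat.mul (by exact_mod_cast hk0) (by exact_mod_cast htK.ne'),
    one_mul, mul_one,
    show (8 : ℚ) / ((Wd.shaOrder : ℚ) * (Wd.tamagawaProduct : ℚ) * (W.tamagawaProduct : ℚ)) =
      (((2 ^ 3 : ℕ) : ℕ) : ℚ) / ((Wd.shaOrder * Wd.tamagawaProduct * W.tamagawaProduct : ℕ) : ℚ) by push_cast; ring,
    padicValRat.div (by positivity) (by exact_mod_cast mul_ne_zero (mul_ne_zero hsha0 hcWdpos.ne') hcWpos.ne'),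
    show ((AddSubgroup.zmultiples P).index : ℚ) = (((AddSubgroup.zmultiples P).index : ℕ) : ℚ) from rfl,
    show ((W.baseChange K).torsionOrder : ℚ) = (((W.baseChange K).torsionOrder : ℕ) : ℚ) from rfl,
    show (k : ℚ) = ((k : ℕ) : ℚ) from rfl, show (2 : ℚ) = ((2 : ℕ) : ℚ) by norm_num,
    padicValRat.of_nat, padicValRat.of_nat, padicValRat.of_nat, padicValRat.of_nat, padicValRat.of_nat,
    padicValRat.of_nat, padicValNat.prime_pow,
    padicValNat.mul (mul_ne_zero hsha0 hcWdpos.ne') hcWpos.ne', padicValNat.mul hsha0 hcWdpos.ne', hcW, hcWd,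
    show padicValNat 2 2 = 1 from padicValNat_self]
  push_cast
  ring

end ExactOrder

end Summit.BirchSwinnertonDyer.BirchSwinnertonDyer.Theorems.GoldfeldGoodTwists

end
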